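import Summits.AnomalousDissipation.AnomalousDissipation.Theorems.MomentParityGalerkinInvariantLoudStubShiftFamily
import Summits.AnomalousDissipation.AnomalousDissipation.Theorems.MomentParityGalerkinInvariantLoudStubHaarSymmetrise
import Summits.AnomalousDissipation.AnomalousDissipation.Theorems.GalerkinInvariantLoud.Negative.Clauses

/-!
# Witnesses of `GalerkinInvariantLoud` for a shear-invariant force are WLOG translation-symmetric in law

Tools file of the line `symmetrised-profile-frozen-quiet-split` (crux `MomentParity.GalerkinInvariantLoud`,
stmt-AnomalousDissipation-14283; lead prover-line-stmt-AnomalousDissipation-14283-c2-0). It records, at the level of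
the CRUX'S OWN witness predicate `GalerkinInvariantLoud.Negative.IsGILWitness f ν N R E ε μ` (probability,
level-`N`, supported in `‖u‖ ≤ R`, all-order stationary, energy `≤ E`, dissipation `≥ ε`), the corollary of the
two landed stubs S1 (`ShiftFamily.stub_shiftFamily`: a jointly continuous translation action on `H`) and S2
(`HaarSymmetrise.stub_haarSymmetrise`: Haar averaging over the shear torus keeps level, radius, all-order
stationarity, energy and dissipation and produces translation symmetry in law):

* `isGILWitness_symmetrise` — for a smooth force invariant under the shear torus `{c : c 1 = 0}` (e.g. any
  Kolmogorov force `sin(2πm x₁) e₀`), every GIL witness at `(f, ν, N, R, E, ε)` can be replaced by one that is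
  TRANSLATION SYMMETRIC IN LAW (every polynomial cylindrical moment with level-`N` band tests unchanged under
  `g ↦ g(· + c)`, `c 1 = 0`) with the same parameters. This is the idea card's transfer
  "GIL(f_K) ⟺ SymGIL(f_K)" made unconditional: refuters of the crux at a shear-invariant force may assume
  symmetric witnesses (mean flow a shear profile, Reynolds stress pinned by the degree-one rows), provers lose
  nothing by symmetrising.
* `stub_symmetricWitnessTools` — the registered tools sub-stub (the statement above, closed by name).
-/

namespace Summit.AnomalousDissipation.AnomalousDissipation.Theorems.GalerkinInvariantLoud.SymmetricWitness

open MeasureTheory Filter Topology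
open scoped ENNReal InnerProductSpace RealInnerProductSpace
open Literature.Analysis.FunctionSpaces Literature.Analysis.FluidPDE
open Summit.AnomalousDissipation.AnomalousDissipation.Theorems.QuarticGate.Negative
open Summit.AnomalousDissipation.AnomalousDissipation.Theorems.CubicParityLoud.Negative (T3 R3 H3 L2T3 frameG)
open Summit.AnomalousDissipation.AnomalousDissipation.Theorems.GalerkinInvariantLoud.Negative
  (IsInvariant IsGILWitness isInvariant_iff_forall)

set_option linter.dupNamespace false

noncomputable section

/-- **GIL witnesses of a shear-invariant force are WLOG translation-symmetric in law.** If `f` is smooth and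
invariant under the shear torus `{c : c 1 = 0}`, then every witness of `GalerkinInvariantLoud` at
`(f, ν, N, R, E, ε)` (`IsGILWitness`: probability, level-`N` carried, supported in `‖u‖ ≤ R`, all-order
polynomially stationary for Galerkin NS at `(ν, f)`, mean energy `≤ E`, dissipation `≥ ε`) yields a witness
with the same parameters all of whose polynomial cylindrical moments with level-`N` band tests are invariant
under translating the tests by any `c` with `c 1 = 0`. Proof: Haar-average the witness over the shear torus
with the jointly continuous shift family of `ShiftFamily.stub_shiftFamily` (`HaarSymmetrise.stub_haarSymmetrise`
keeps level, radius and all-order stationarity and preserves energy and dissipation exactly). [folklore] -/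
theorem isGILWitness_symmetrise {f : T3 → R3} (hf : Torus.IsSmooth f)
    (hfinv : ∀ c : T3, c 1 = 0 → ∀ x, f (x + c) = f x) {ν : ℝ} {N : ℕ} {R E ε : ℝ} {μ : Measure H3}
    (h : IsGILWitness f ν N R E ε μ) :
    ∃ μ' : Measure H3, IsGILWitness f ν N R E ε μ' ∧
      ∀ c : T3, c 1 = 0 → ∀ (m : ℕ) (g : Fin m → T3 → R3) (P : MvPolynomial (Fin m) ℝ),
        (∀ i, IsBandTest N (g i)) →
          ∫ u, MvPolynomial.eval (fun i => Torus.pairing u.1 (g i)) P ∂μ' =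
            ∫ u, MvPolynomial.eval (fun i => Torus.pairing u.1 (fun x => g i (x + c))) P ∂μ' := by
  obtain ⟨hp, hl, hR, hinv, hE, hD⟩ := h
  obtain ⟨T, hTae, hTc⟩ := ShiftFamily.stub_shiftFamily
  obtain ⟨μ', hp', hl', hR', hst', hsym, hE', hD'⟩ :=
    HaarSymmetrise.stub_haarSymmetrise T hTae hTc ν f N R μ hf hfinv hp hl hR (isInvariant_iff_forall.1 hinv)
  exact ⟨μ', ⟨hp', hl', hR', isInvariant_iff_forall.2 hst', hE'.symm ▸ hE, hD'.symm ▸ hD⟩, hsym⟩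

/-- **Registered tools sub-stub `stub_symmetricWitnessTools`** of the line `symmetrised-profile-frozen-quiet-split`
(`ledger workitem stub-add stmt-AnomalousDissipation-14283 --name stub_symmetricWitnessTools`): GIL witnesses of a
smooth shear-invariant force are WLOG translation-symmetric in law (`isGILWitness_symmetrise`). [folklore] -/
theorem stub_symmetricWitnessTools :
    ∀ (f : T3 → R3), Torus.IsSmooth f → (∀ c : T3, c 1 = 0 → ∀ x, f (x + c) = f x) →
      ∀ (ν : ℝ) (N : ℕ) (R E ε : ℝ) (μ : Measure H3), IsGILWitness f ν N R E ε μ →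
        ∃ μ' : Measure H3, IsGILWitness f ν N R E ε μ' ∧
          ∀ c : T3, c 1 = 0 → ∀ (m : ℕ) (g : Fin m → T3 → R3) (P : MvPolynomial (Fin m) ℝ),
            (∀ i, IsBandTest N (g i)) →
              ∫ u, MvPolynomial.eval (fun i => Torus.pairing u.1 (g i)) P ∂μ' =
                ∫ u, MvPolynomial.eval (fun i => Torus.pairing u.1 (fun x => g i (x + c))) P ∂μ' :=
  fun _ hf hfinv _ _ _ _ _ _ h => isGILWitness_symmetrise hf hfinv h

end

end Summit.AnomalousDissipation.AnomalousDissipation.Theorems.GalerkinInvariantLoud.SymmetricWitness
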